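import Mathlib
import Literature.MathematicalPhysics.QuantumFieldTheory.QCDThermalDeterminant
import Literature.MathematicalPhysics.QuantumLattice.FermionGammaFunctorTrace

/-!
# Sketch — crux-ideate stmt-QuantumFields-9735 (UnquenchedChessboardBound), round 1, ideator 1

First lemmas of the two idea cards (they elaborate; proofs are not required at this stage).

* Card `rp-peeling-floor`: `transparency` (pendant temporal bonds are invisible to the determinant,
  `P₊P₋ = 0` + Schur complement) and `det_staticWilson_ne_zero` (the time-static Wilson operator —
  temporal hopping deleted — has no kernel on the WHOLE physical branch `m_f > −1`, by the tree's
  `‖H_μ x‖² = 4‖x‖²` with three instead of four hopping matrices).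
* Card `chiral-schur-gram-rp`: `det_one_add_conjTranspose_mul_eq_sum` (Fredholm–Gram expansion through the
  tree's fermionic functor `Γ`: `det(1 + Wᴴ V) = Σ_{S,T} conj Γ(W)_{TS} · Γ(V)_{TS}`, the manifestly
  positive-semidefinite kernel) and `det_fromBlocks_chiral` (the plane Schur block identity).
-/

open scoped Kronecker Matrix ComplexConjugate BigOperators
open Matrix

namespace CruxIdeate.UnquenchedChessboardBound

/-! ## Card 1: rp-peeling-floor -/

/-- Transparency of a bare neighbour slice: coupling a slice operator `B` (site⊗colour index `m`,
spin `Fin 4`) to a slice carrying only the mass term through one temporal bond layer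
(forward hop `∝ X ⊗ P₋`, backward hop `∝ Y ⊗ P₊`, `P₊P₋ = 0`) does not change the determinant. -/
theorem transparency {m : Type*} [Fintype m] [DecidableEq m]
    (Pp Pm : Matrix (Fin 4) (Fin 4) ℂ) (hP : Pp * Pm = 0)
    (X Y : Matrix m m ℂ) (B : Matrix (m × Fin 4) (m × Fin 4) ℂ) :
    (Matrix.fromBlocks (1 : Matrix (m × Fin 4) (m × Fin 4) ℂ) (-(X ⊗ₖ Pm)) (-(Y ⊗ₖ Pp)) B).det
      = B.det := by
  rw [Matrix.det_fromBlocks_one₁₁, neg_mul_neg, ← Matrix.mul_kronecker_mul, hP,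
    Matrix.kronecker_zero, sub_zero]

open Literature.MathematicalPhysics.QuantumFieldTheory in
/-- Terminal positivity of the peeling: with temporal hopping deleted (time-static quarks), the
`N_f`-flavour `r = 1` Wilson operator on `ℤ_{N_t} × (ℤ/N_s)³` has no kernel along the whole spatial
hopping homotopy `t ∈ [0,1]` as soon as every `m_f > −1` (three unit hopping matrices of norm `2`:
`‖(t/2) Σ_j H_j x‖ ≤ 3‖x‖ < (m_f + 4)‖x‖`). Hence its (real) determinant is `> 0` there. -/
theorem det_staticWilson_ne_zero {Nf Nt Ns : ℕ} [NeZero Nt] [NeZero Ns]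
    (U : QCDCircleConfig Nt Ns) {mq : Fin Nf → ℝ} (hm : ∀ f, -1 < mq f)
    {t : ℝ} (ht0 : 0 ≤ t) (ht1 : t ≤ 1) :
    (thermalMassMatrix (Nt := Nt) (Ns := Ns) mq -
        ((t / 2 : ℝ) : ℂ) • ∑ j : Fin 3, thermalHopping (Nf := Nf) U (some j)).det ≠ 0 := by
  sorry

/-- Shape of one peeling step (abstract Cauchy–Schwarz floor): in any complex inner product space,
`‖y‖² ≥ ‖⟪x, y⟫‖² / ‖x‖²` — used with `x = Φ_{E∖X}`, `y = Φ_E` (the Gram vectors of card 2) so that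
`Z(E) · Z(E ∖ (X ∪ ρX)) ≥ |Z(E ∖ ρX)|²`. -/
theorem floor_step {V : Type*} [NormedAddCommGroup V] [InnerProductSpace ℂ V] (x y : V)
    (hx : x ≠ 0) : ‖inner ℂ x y‖ ^ 2 / ‖x‖ ^ 2 ≤ ‖y‖ ^ 2 := by
  rw [div_le_iff₀ (by positivity)]
  nlinarith [norm_inner_le_norm (𝕜 := ℂ) x y, norm_nonneg (inner ℂ x y), norm_nonneg x, norm_nonneg y,
    mul_nonneg (norm_nonneg x) (norm_nonneg y)]

/-! ## Card 2: chiral-schur-gram-rp -/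

open Literature.MathematicalPhysics.QuantumLattice in
/-- Fredholm–Gram expansion through the fermionic functor `Γ` of the tree:
`det(1 + Wᴴ V) = Tr Γ(Wᴴ V) = Tr (Γ(W)ᴴ Γ(V)) = Σ_{S,T} conj Γ(W)_{TS} Γ(V)_{TS}`.
As a kernel in `(V, W)` the right-hand side is manifestly positive semidefinite. -/
theorem det_one_add_conjTranspose_mul_eq_sum {ι : Type*} [LinearOrder ι] [Fintype ι]
    (W V : Matrix ι ι ℂ) :
    (1 + Wᴴ * V).det = ∑ S : Finset ι, ∑ T : Finset ι, conj (Gamma W T S) * Gamma V T S := by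
  sorry

/-- The plane Schur block identity behind marginal site-RP (chirality split): if the lower-half
Schur datum is minus the adjoint of an upper-type datum, `N_B = -N'ᴴ`, and the cross blocks
`C₁, C₂` (the chirality-diagonal spatial Wilson operators `(m+4)(1 − K h)`, positive definite iff
`6K < 1`) are invertible, then
`det [[N, C₁],[C₂, -N'ᴴ]] = (-1)^{|m|} det C₁ · det C₂ · det(1 + C₂⁻¹ N'ᴴ C₁⁻¹ N)`. -/
theorem det_fromBlocks_chiral {m : Type*} [Fintype m] [DecidableEq m]
    (N N' C₁ C₂ : Matrix m m ℂ) (h₁ : IsUnit C₁.det) (h₂ : IsUnit C₂.det) :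
    (Matrix.fromBlocks N C₁ C₂ (-N'ᴴ)).det =
      (-1) ^ Fintype.card m * C₁.det * C₂.det * (1 + C₂⁻¹ * N'ᴴ * C₁⁻¹ * N).det := by
  sorry

end CruxIdeate.UnquenchedChessboardBound
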